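import Literature.Algebra.Homology.ClassModuleTransport
import Literature.Algebra.Homology.NormGroups
import HarnessLib

/-!
# The norm residue symbol of a class module under transport of structure `(e, ε) : (G, A) ≅ (G', B)`
# (Serre, *Local Fields* XI §1 (iv); Neukirch, *Bonn Lectures* II §1 Thm. (1.9))

Topic `Algebra/Homology`; namespace `Literature.Algebra.Homology`.  Theorems only (no definition, no named fact, no
instance, no notation, no `sorry`).  Sequel to the tree's `NormGroups` (`IsClassModule.normResidueSymbol`) and `ClassModuleTransport` (`IsClassModule.of_iso`: an
isomorphism of layers `(e, ε) : (G, A) ≅ (G', B)` carries a fundamental class to `e_* φ`).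

* (the quotient-layer half, Neukirch II (1.11) a), is the tree's `IsClassModule.normResidueSymbol_quotientLayer` in
  `NormResidueGroup.lean`; not restated here.)
* **`IsClassModule.normResidueSymbol_of_iso`** — along a group isomorphism `e : G ≃* G'` and an `e`-equivariant linear
  isomorphism `ε : A ≅ B`: `(ε a, ·)_{e_* φ} = e^{ab} (a, ·)_{φ}` (transport of structure, Serre XI §1 (iv)); with
  `nakayamaSum_transport` (`Σ_τ (e_*φ)(τ, e g) = ε (Σ_τ φ(τ, g))`) and `norm_transport` (`N_{G'} ∘ ε = ε ∘ N_G`).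

USE (cell bsd-schneider, Route A / Tate VII §11.3 beyond cyclic layers): comparing the norm residue symbol of the idèle class
layer `(Gal(E/F), C_E)` on its quotient layers with those of the sub-extensions `(Gal(K/F), C_K)` through the descent
identification `C_K ≅ (C_E)^{Gal(E/K)}`.

## References
* J. Neukirch, *Class Field Theory — The Bonn Lectures* (2013), Part II §1 Thm. (1.11) a), Thm. (1.9). [Neukirch2013]
* J.-P. Serre, *Local Fields*, GTM 67 (1979), XI §1 (iv), XI §3 (4). [Serre1979]
* S. Lang, *Topics in Cohomology of Groups* (1996), IX §2 Thm. 2.3 (i) (consistency). [Lang1996]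
-/

noncomputable section

open CategoryTheory CategoryTheory.Limits groupCohomology

namespace Literature.Algebra.Homology

attribute [-instance] AddCommGroup.toIntModule

/-! ## Transport of structure along `(e, ε) : (G, A) ≅ (G', B)` -/

section Transport

variable {G G' : Type} [Group G] [Group G'] [Fintype G] [Fintype G'] (e : G ≃* G')
  {A : Rep.{0} ℤ G} {B : Rep.{0} ℤ G'} (ε : A.V ≃ₗ[ℤ] B.V)
  (hε : ∀ g : G, ε.toLinearMap ∘ₗ A.ρ g = B.ρ (e g) ∘ₗ ε.toLinearMap)

omit [Fintype G] [Fintype G'] in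
include hε in
/-- `ε (g · x) = e(g) · ε x`. [cite: Serre1979, XI §1 (iv)] -/
theorem LayerIso.apply_ρ (g : G) (x : A.V) : ε (A.ρ g x) = B.ρ (e g) (ε x) :=
  LinearMap.congr_fun (hε g) x

omit [Fintype G] [Fintype G'] in
include hε in
/-- **`ε` carries `G`-invariants to `G'`-invariants.** [cite: Serre1979, XI §1 (iv)] -/
theorem LayerIso.apply_mem_invariants (a : A.ρ.invariants) : ε (a : A.V) ∈ B.ρ.invariants := fun g' => by
  obtain ⟨g, rfl⟩ := e.surjective g'
  rw [← LayerIso.apply_ρ e ε hε, a.2 g]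

include hε in
/-- **`ε ∘ N_G = N_{G'} ∘ ε`**: the norm is transported (reindex the sum along `e`). [cite: Serre1979, XI §1 (iv)] -/
theorem LayerIso.norm_transport (x : A.V) : ε (A.ρ.norm x) = B.ρ.norm (ε x) := by
  rw [Representation.norm, Representation.norm, LinearMap.sum_apply, LinearMap.sum_apply, map_sum]
  simp_rw [LayerIso.apply_ρ e ε hε]
  exact Fintype.sum_equiv e.toEquiv _ _ fun _ => rfl

include hε in
/-- The norm subgroups correspond: `ε x ∈ N_{G'} B ↔ x ∈ N_G A`. [cite: Serre1979, XI §1 (iv)] -/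
theorem LayerIso.apply_mem_range_norm_iff (x : A.V) :
    ε x ∈ LinearMap.range B.ρ.norm ↔ x ∈ LinearMap.range A.ρ.norm := by
  constructor
  · rintro ⟨y, hy⟩
    refine ⟨ε.symm y, ε.injective ?_⟩
    rw [LayerIso.norm_transport e ε hε, LinearEquiv.apply_symm_apply, hy]
  · rintro ⟨y, rfl⟩
    exact ⟨ε y, (LayerIso.norm_transport e ε hε y).symm⟩

/-- **The Nakayama sums are transported**: `Σ_{τ'} (e_* φ)(τ', e g) = ε (Σ_τ φ(τ, g))`, `e_* φ = Z²(e⁻¹, ε) φ`.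
[cite: Neukirch2013, Part I §5 Prop. (5.8)][cite: Serre1979, XI §1 (iv)] -/
theorem LayerIso.nakayamaSum_transport (φ : cocycles₂ A) (g : G) :
    ((Nakayama.nakayamaSum (mapCocycles₂ (e.symm : G' →* G)
        (Rep.ofHom ⟨ε.toLinearMap, LayerIso.isIntertwining_symm e A B ε hε⟩) φ) (e g) : B.ρ.invariants) : B.V) =
      ε ((Nakayama.nakayamaSum φ g : A.ρ.invariants) : A.V) := by
  rw [Nakayama.coe_nakayamaSum, Nakayama.coe_nakayamaSum, map_sum]
  refine (Fintype.sum_equiv e.symm.toEquiv _ _ fun τ' => ?_)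
  change ε ((φ : G × G → A.V) (e.symm τ', e.symm (e g))) = ε ((φ : G × G → A.V) (e.symm.toEquiv τ', g))
  rw [MulEquiv.symm_apply_apply]
  rfl

/-- **Transport of the norm residue symbol**: for a class module `(A, φ)` of `G` and an isomorphism of layers
`(e, ε) : (G, A) ≅ (G', B)`, the symbol of the transported class module `(B, e_* φ)` (`IsClassModule.of_iso`) at `ε a` is
`e^{ab} (a, ·)_φ` for every `a ∈ A^G`. [cite: Serre1979, XI §1 (iv)][cite: Neukirch2013, Part II §1 Thm. (1.9)] -/
theorem IsClassModule.normResidueSymbol_of_iso {φ : cocycles₂ A} (hA : IsClassModule A φ) (a : A.ρ.invariants) :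
    (hA.of_iso e ε hε).normResidueSymbol ⟨ε (a : A.V), LayerIso.apply_mem_invariants e ε hε a⟩ =
      Abelianization.map e.toMonoidHom (hA.normResidueSymbol a) := by
  -- `(a, ·)_φ = ḡ₀⁻¹` for some `g₀`, so `a ≡ Σ_τ φ(τ, g₀) mod N_G A`
  obtain ⟨x, hx⟩ : ∃ x : Abelianization G, x = hA.normResidueSymbol a := ⟨_, rfl⟩
  induction x using QuotientGroup.induction_on with
  | H g =>
    set g₀ := g⁻¹ with hg₀
    have ha : hA.normResidueSymbol a = hA.normResidueSymbol (Nakayama.nakayamaSum φ g₀) := by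
      rw [hA.normResidueSymbol_nakayamaSum, ← hx, hg₀, map_inv, inv_inv]
      rfl
    have hmem := (hA.normResidueSymbol_eq_iff a (Nakayama.nakayamaSum φ g₀)).1 ha
    -- transport the congruence: `ε a ≡ Σ_{τ'} ψ(τ', e g₀) mod N_{G'} B`
    have hmem' : (((⟨ε (a : A.V), LayerIso.apply_mem_invariants e ε hε a⟩ : B.ρ.invariants) -
        Nakayama.nakayamaSum (mapCocycles₂ (e.symm : G' →* G) (Rep.ofHom ⟨ε.toLinearMap, LayerIso.isIntertwining_symm e A B ε hε⟩) φ) (e g₀) : B.ρ.invariants) : B.V) ∈ LinearMap.range B.ρ.norm := by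
      have h1 : (((⟨ε (a : A.V), LayerIso.apply_mem_invariants e ε hε a⟩ : B.ρ.invariants) -
          Nakayama.nakayamaSum (mapCocycles₂ (e.symm : G' →* G) (Rep.ofHom ⟨ε.toLinearMap, LayerIso.isIntertwining_symm e A B ε hε⟩) φ) (e g₀) : B.ρ.invariants) : B.V) =
          ε (((a - Nakayama.nakayamaSum φ g₀ : A.ρ.invariants) : A.V)) := by
        rw [Submodule.coe_sub, Submodule.coe_sub, map_sub, LayerIso.nakayamaSum_transport e ε hε φ g₀]
      rw [h1, LayerIso.apply_mem_range_norm_iff e ε hε]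
      exact hmem
    rw [((hA.of_iso e ε hε).normResidueSymbol_eq_iff _ _).2 hmem', (hA.of_iso e ε hε).normResidueSymbol_nakayamaSum,
      ← hx, hg₀, map_inv, map_inv, inv_inv]
    rfl

end Transport

end Literature.Algebra.Homology

end
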